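import Literature.Analysis.FluidPDE.AncientLPSLiouvilleBootstrap
import Literature.Analysis.FluidPDE.SobolevWholeSpace
import Literature.Analysis.FluidPDE.NSWeakStrongUniquenessProofs
import Literature.Analysis.FluidPDE.TaoEnstrophyLocalisationProofs
import Literature.Analysis.UnboundedOperators.HeatKernelLpSmoothingProofs
import HarnessLib

/-!
# Tools for `QuarterLogPincer.LogCubeCeiling` (item stmt-NavierStokesRegularity-23362): the Abel–log
# time integral and Sobolev against the enstrophy

`--supports stmt-NavierStokesRegularity-23362`. The item says: under the quarter-rate enstrophy law
`∫|curl u(t)|² ≤ K/√(T−t)` a classical Leray–Hopf solution has `‖u(t)‖_{L³} ≤ C₁ + C₂ log(T/(T−t))`.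
The proof (file `QuarterLogPincerLogCubeCeiling.lean`) runs the Oseen/Duhamel representation; this file
holds its three solution-free lemmas:

* `lintegral_kernel_le_log` — `∫_{(0,s)} (s−τ)^{-1/2}(T−τ)^{-1/2} dτ ≤ 2 + √2 log(T/(T−s))` for
  `0 < s < T` (where the logarithm of the ceiling comes from: the Oseen kernel gradient has `L¹` size
  `∝ (s−τ)^{-1/2}` and the enstrophy is spent at Leray's rate `(T−τ)^{-1/2}`);
* `eLpNorm_six_mul_self_le_curl` — `‖v‖₆² ≤ K_S² ∫|curl v|²` for `C²` divergence-free `L²` fields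
  (Mathlib's Gagliardo–Nirenberg–Sobolev constant `K_S`; `∫|Dv|²_F ≤ ∫|curl v|²`);
* `eLpNorm_three_lt_top_of_bounded` — `L² ∩ L^∞ ⊂ L³`.

HONEST FRAMING: calculus and function-space lemmas; nothing here concerns Navier–Stokes regularity.
References: Evans, PDE §5.6.1 (Sobolev); Kato 1984 §2 (the kernel `(t−s)^{-1/2}`). [folklore]
-/

noncomputable section

open Set Filter Topology MeasureTheory Function
open scoped ENNReal NNReal
open Literature.Analysis Literature.Analysis.FluidPDE

namespace Summit.NavierStokesRegularity.NavierStokesRegularity.Theorems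

-- the problem directory repeats the summit name (`NavierStokesRegularity/NavierStokesRegularity`)
set_option linter.dupNamespace false

namespace LogCubeCeiling

/-! ### The time integral: `∫₀ˢ (s−τ)^{-1/2}(T−τ)^{-1/2} dτ ≤ 2 + √2 log(T/(T−s))` -/

/-- **The Abel–log kernel integral.** For `0 < s < T`,
`∫_{(0,s)} (s−τ)^{-1/2} (T−τ)^{-1/2} dτ ≤ 2 + √2·log(T/(T−s))` (split at `max(0, 2s−T)`: on the late
piece `T−τ ≥ T−s` and `∫(s−τ)^{-1/2} = 2√(s−s₀) ≤ 2√(T−s)`; on the early piece `T−τ ≤ 2(s−τ)`, so the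
integrand is `≤ √2/(T−τ)`, which integrates to `√2 log(T/(T−s₀)) ≤ √2 log(T/(T−s))`). [folklore] -/
theorem lintegral_kernel_le_log {s T : ℝ} (hs : 0 < s) (hsT : s < T) :
    ∫⁻ τ in Ioo 0 s, ENNReal.ofReal ((s - τ) ^ (-(1 / 2 : ℝ))) *
        ENNReal.ofReal ((T - τ) ^ (-(1 / 2 : ℝ))) ≤
      ENNReal.ofReal (2 + Real.sqrt 2 * Real.log (T / (T - s))) := by
  set s₀ : ℝ := max 0 (2 * s - T) with hs₀
  have hs₀0 : 0 ≤ s₀ := le_max_left _ _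
  have hs₀s : s₀ < s := max_lt hs (by linarith)
  have hs₀ge : 2 * s - T ≤ s₀ := le_max_right _ _
  have hTs : 0 < T - s := sub_pos.2 hsT
  have hT : 0 < T := hs.trans hsT
  have hlog : 0 ≤ Real.log (T / (T - s)) :=
    Real.log_nonneg ((one_le_div hTs).2 (by linarith))
  -- ### the late piece `(s₀, s)`
  have hA : ∫⁻ τ in Ioo s₀ s, ENNReal.ofReal ((s - τ) ^ (-(1 / 2 : ℝ))) *
      ENNReal.ofReal ((T - τ) ^ (-(1 / 2 : ℝ))) ≤ ENNReal.ofReal 2 := by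
    calc ∫⁻ τ in Ioo s₀ s, ENNReal.ofReal ((s - τ) ^ (-(1 / 2 : ℝ))) *
          ENNReal.ofReal ((T - τ) ^ (-(1 / 2 : ℝ)))
        ≤ ∫⁻ τ in Ioo s₀ s, ENNReal.ofReal ((s - τ) ^ (-(1 / 2 : ℝ))) *
            ENNReal.ofReal ((T - s) ^ (-(1 / 2 : ℝ))) := by
          refine setLIntegral_mono' measurableSet_Ioo fun τ hτ => ?_
          exact mul_le_mul' le_rfl (ENNReal.ofReal_le_ofReal
            (Real.rpow_le_rpow_of_nonpos hTs (by linarith [hτ.2]) (by norm_num)))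
      _ = (∫⁻ τ in Ioo s₀ s, ENNReal.ofReal ((s - τ) ^ (-(1 / 2 : ℝ)))) *
            ENNReal.ofReal ((T - s) ^ (-(1 / 2 : ℝ))) :=
          lintegral_mul_const _ (measurable_ofReal_rpow_sub_left s (1 / 2))
      _ ≤ ENNReal.ofReal ((s - s₀) ^ (1 - 1 / 2 : ℝ) / (1 - 1 / 2)) *
            ENNReal.ofReal ((T - s) ^ (-(1 / 2 : ℝ))) :=
          mul_le_mul' (lintegral_Ioo_ofReal_rpow_neg_sub_le (γ := 1 / 2) (by norm_num)
            hs₀s.le le_rfl) le_rfl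
      _ = ENNReal.ofReal (2 * ((s - s₀) ^ (1 / 2 : ℝ) * (T - s) ^ (-(1 / 2 : ℝ)))) := by
          rw [← ENNReal.ofReal_mul (by positivity)]
          congr 1
          norm_num
          ring
      _ ≤ ENNReal.ofReal 2 := by
          apply ENNReal.ofReal_le_ofReal
          have h1 : s - s₀ ≤ T - s := by linarith
          have h2 : (s - s₀) ^ (1 / 2 : ℝ) ≤ (T - s) ^ (1 / 2 : ℝ) :=
            Real.rpow_le_rpow (sub_nonneg.2 hs₀s.le) h1 (by norm_num)
          have h3 : (T - s) ^ (1 / 2 : ℝ) * (T - s) ^ (-(1 / 2 : ℝ)) = 1 := by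
            rw [← Real.rpow_add hTs]; norm_num
          have h4 : 0 ≤ (T - s) ^ (-(1 / 2 : ℝ)) := Real.rpow_nonneg hTs.le _
          calc 2 * ((s - s₀) ^ (1 / 2 : ℝ) * (T - s) ^ (-(1 / 2 : ℝ)))
              ≤ 2 * ((T - s) ^ (1 / 2 : ℝ) * (T - s) ^ (-(1 / 2 : ℝ))) := by gcongr
            _ = 2 := by rw [h3, mul_one]
  -- ### the early piece `(0, s₀)`
  have hB : ∫⁻ τ in Ioo 0 s₀, ENNReal.ofReal ((s - τ) ^ (-(1 / 2 : ℝ))) *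
      ENNReal.ofReal ((T - τ) ^ (-(1 / 2 : ℝ))) ≤
        ENNReal.ofReal (Real.sqrt 2 * Real.log (T / (T - s))) := by
    rcases eq_or_lt_of_le hs₀0 with h0 | hpos
    · rw [← h0, Ioo_self, Measure.restrict_empty, lintegral_zero_measure]
      exact bot_le
    · have hs₀eq : s₀ = 2 * s - T := by
        rcases le_total 0 (2 * s - T) with h | h
        · rw [hs₀, max_eq_right h]
        · exfalso
          have : s₀ = 0 := by rw [hs₀, max_eq_left h]
          linarith
      have hTs₀ : 0 < T - s₀ := by linarith
      have hint : IntegrableOn (fun τ : ℝ => Real.sqrt 2 * (T - τ)⁻¹) (Ioo 0 s₀) volume := by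
        have hc : ContinuousOn (fun τ : ℝ => Real.sqrt 2 * (T - τ)⁻¹) (Icc 0 s₀) := by
          refine ContinuousOn.mul continuousOn_const (ContinuousOn.inv₀ ?_ ?_)
          · exact (continuous_const.sub continuous_id).continuousOn
          · intro τ hτ
            exact (show (0 : ℝ) < T - τ by linarith [hτ.2]).ne'
        exact (hc.integrableOn_Icc).mono_set Ioo_subset_Icc_self
      have hnn : 0 ≤ᵐ[volume.restrict (Ioo 0 s₀)] fun τ : ℝ => Real.sqrt 2 * (T - τ)⁻¹ := by
        refine (ae_restrict_iff' measurableSet_Ioo).2 (Eventually.of_forall fun τ hτ => ?_)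
        have : 0 < T - τ := by linarith [hτ.2]
        positivity
      calc ∫⁻ τ in Ioo 0 s₀, ENNReal.ofReal ((s - τ) ^ (-(1 / 2 : ℝ))) *
            ENNReal.ofReal ((T - τ) ^ (-(1 / 2 : ℝ)))
          ≤ ∫⁻ τ in Ioo 0 s₀, ENNReal.ofReal (Real.sqrt 2 * (T - τ)⁻¹) := by
            refine setLIntegral_mono' measurableSet_Ioo fun τ hτ => ?_
            have hsτ : 0 < s - τ := by linarith [hτ.2]
            have hTτ : 0 < T - τ := by linarith [hτ.2]
            have hle : T - τ ≤ 2 * (s - τ) := by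
              have : τ < 2 * s - T := hs₀eq ▸ hτ.2
              linarith
            rw [← ENNReal.ofReal_mul (Real.rpow_nonneg hsτ.le _)]
            apply ENNReal.ofReal_le_ofReal
            have h1 : (s - τ) ^ (-(1 / 2 : ℝ)) ≤ ((T - τ) / 2) ^ (-(1 / 2 : ℝ)) :=
              Real.rpow_le_rpow_of_nonpos (by positivity) (by linarith) (by norm_num)
            have h2 : ((T - τ) / 2) ^ (-(1 / 2 : ℝ)) = Real.sqrt 2 * (T - τ) ^ (-(1 / 2 : ℝ)) := by
              rw [Real.div_rpow hTτ.le zero_le_two, Real.rpow_neg zero_le_two,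
                ← Real.sqrt_eq_rpow, div_inv_eq_mul, mul_comm]
            have h3 : (T - τ) ^ (-(1 / 2 : ℝ)) * (T - τ) ^ (-(1 / 2 : ℝ)) = (T - τ)⁻¹ := by
              rw [← Real.rpow_add hTτ, show (-(1 / 2 : ℝ)) + -(1 / 2 : ℝ) = -1 by norm_num,
                Real.rpow_neg_one]
            calc (s - τ) ^ (-(1 / 2 : ℝ)) * (T - τ) ^ (-(1 / 2 : ℝ))
                ≤ (Real.sqrt 2 * (T - τ) ^ (-(1 / 2 : ℝ))) * (T - τ) ^ (-(1 / 2 : ℝ)) := by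
                  gcongr
                  exact h1.trans_eq h2
              _ = Real.sqrt 2 * (T - τ)⁻¹ := by rw [mul_assoc, h3]
        _ = ENNReal.ofReal (∫ τ in Ioo 0 s₀, Real.sqrt 2 * (T - τ)⁻¹) :=
            (ofReal_integral_eq_lintegral_ofReal hint hnn).symm
        _ = ENNReal.ofReal (Real.sqrt 2 * Real.log (T / (T - s₀))) := by
            congr 1
            rw [← integral_Ioc_eq_integral_Ioo, ← intervalIntegral.integral_of_le hpos.le,
              intervalIntegral.integral_const_mul,
              intervalIntegral.integral_comp_sub_left (fun x : ℝ => x⁻¹) T, sub_zero,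
              integral_inv_of_pos hTs₀ hT]
        _ ≤ ENNReal.ofReal (Real.sqrt 2 * Real.log (T / (T - s))) := by
            apply ENNReal.ofReal_le_ofReal
            gcongr
  -- ### combine
  have hsub : Ioo 0 s ⊆ Ioo 0 s₀ ∪ Ico s₀ s := fun τ hτ => by
    rcases lt_or_ge τ s₀ with h' | h'
    · exact Or.inl ⟨hτ.1, h'⟩
    · exact Or.inr ⟨h', hτ.2⟩
  calc ∫⁻ τ in Ioo 0 s, ENNReal.ofReal ((s - τ) ^ (-(1 / 2 : ℝ))) *
        ENNReal.ofReal ((T - τ) ^ (-(1 / 2 : ℝ)))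
      ≤ ∫⁻ τ in Ioo 0 s₀ ∪ Ico s₀ s, ENNReal.ofReal ((s - τ) ^ (-(1 / 2 : ℝ))) *
          ENNReal.ofReal ((T - τ) ^ (-(1 / 2 : ℝ))) := lintegral_mono_set hsub
    _ ≤ (∫⁻ τ in Ioo 0 s₀, ENNReal.ofReal ((s - τ) ^ (-(1 / 2 : ℝ))) *
          ENNReal.ofReal ((T - τ) ^ (-(1 / 2 : ℝ)))) +
        ∫⁻ τ in Ico s₀ s, ENNReal.ofReal ((s - τ) ^ (-(1 / 2 : ℝ))) *
          ENNReal.ofReal ((T - τ) ^ (-(1 / 2 : ℝ))) := lintegral_union_le _ _ _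
    _ = (∫⁻ τ in Ioo 0 s₀, ENNReal.ofReal ((s - τ) ^ (-(1 / 2 : ℝ))) *
          ENNReal.ofReal ((T - τ) ^ (-(1 / 2 : ℝ)))) +
        ∫⁻ τ in Ioo s₀ s, ENNReal.ofReal ((s - τ) ^ (-(1 / 2 : ℝ))) *
          ENNReal.ofReal ((T - τ) ^ (-(1 / 2 : ℝ))) := by
        rw [setLIntegral_congr (Ioo_ae_eq_Ico (μ := (volume : Measure ℝ)) (a := s₀) (b := s))]
    _ ≤ ENNReal.ofReal (Real.sqrt 2 * Real.log (T / (T - s))) + ENNReal.ofReal 2 :=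
        add_le_add hB hA
    _ = ENNReal.ofReal (2 + Real.sqrt 2 * Real.log (T / (T - s))) := by
        rw [← ENNReal.ofReal_add (by positivity) zero_le_two, add_comm]

/-! ### Sobolev against the enstrophy, and `L² ∩ L^∞ ⊂ L³` -/

/-- **Sobolev against the enstrophy**: for a `C²` divergence-free `L²` field `v` on `ℝ³`,
`‖v‖₆ · ‖v‖₆ ≤ K_S² ∫|curl v|²`, `K_S` Mathlib's Gagliardo–Nirenberg–Sobolev constant
(`Ḣ¹ ⊂ L⁶`: `eLpNorm_six_le_eLpNorm_fderiv_two`; `‖Dv‖_{L²} ≤ (∫|Dv|²_F)^{1/2}`;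
`∫|Dv|²_F ≤ ∫|curl v|²` for divergence-free fields). [folklore] -/
theorem eLpNorm_six_mul_self_le_curl {v : (EuclideanSpace ℝ (Fin 3)) → (EuclideanSpace ℝ (Fin 3))} (hv : ContDiff ℝ 2 v)
    (hdiv : VectorCalculus.IsDivFree v) (hv2 : MemLp v 2 volume) :
    eLpNorm v 6 volume * eLpNorm v 6 volume ≤
      (SNormLESNormFDerivOfEqConst (EuclideanSpace ℝ (Fin 3)) (volume : Measure (EuclideanSpace ℝ (Fin 3))) 2 : ℝ≥0∞) ^ 2 *
        ∫⁻ x, ‖curl v x‖ₑ ^ 2 := by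
  set KS : ℝ≥0∞ := (SNormLESNormFDerivOfEqConst (EuclideanSpace ℝ (Fin 3)) (volume : Measure (EuclideanSpace ℝ (Fin 3))) 2 : ℝ≥0∞) with hKS
  set Z : ℝ≥0∞ := ∫⁻ x, ‖curl v x‖ₑ ^ 2 with hZ
  have hL2 : ∫⁻ x, ‖v x‖ₑ ^ 2 < ⊤ := by
    have h := lintegral_rpow_enorm_lt_top_of_eLpNorm_lt_top two_ne_zero ENNReal.ofNat_ne_top
      hv2.eLpNorm_lt_top
    simpa [ENNReal.toReal_ofNat] using h
  have h1 : eLpNorm v 6 volume ≤ KS * eLpNorm (fderiv ℝ v) 2 volume :=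
    eLpNorm_six_le_eLpNorm_fderiv_two volume finrank_euclideanSpace_fin
      (hv.of_le (by norm_num)) hv2.eLpNorm_lt_top
  have h2 : eLpNorm (fderiv ℝ v) 2 volume ≤
      (∫⁻ x, ENNReal.ofReal (frobeniusNormSq (fderiv ℝ v x))) ^ (1 / 2 : ℝ) :=
    eLpNorm_two_le_lintegral_frobenius_rpow volume _
  have h3 : ∫⁻ x, ENNReal.ofReal (frobeniusNormSq (fderiv ℝ v x)) ≤ Z :=
    lintegral_frobeniusNormSq_fderiv_le_lintegral_sq_norm_curl hv hdiv hL2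
  have hS6 : eLpNorm v 6 volume ≤ KS * Z ^ (1 / 2 : ℝ) :=
    h1.trans (mul_le_mul' le_rfl (h2.trans (ENNReal.rpow_le_rpow h3 (by norm_num))))
  calc eLpNorm v 6 volume * eLpNorm v 6 volume
      ≤ (KS * Z ^ (1 / 2 : ℝ)) * (KS * Z ^ (1 / 2 : ℝ)) := mul_le_mul' hS6 hS6
    _ = KS ^ 2 * (Z ^ (1 / 2 : ℝ) * Z ^ (1 / 2 : ℝ)) := by ring
    _ = KS ^ 2 * Z := by
        rw [← ENNReal.rpow_add_of_nonneg _ _ (by norm_num : (0 : ℝ) ≤ 1 / 2) (by norm_num),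
          show (1 / 2 : ℝ) + 1 / 2 = 1 by norm_num, ENNReal.rpow_one]

/-- A bounded (`‖f‖ ≤ M`), square-integrable, measurable field on `ℝ³` has finite `L³` norm
(`‖f‖₃ ≤ ‖f‖₂^{2/3} ‖f‖_∞^{1/3}`). [folklore] -/
theorem eLpNorm_three_lt_top_of_bounded {f : (EuclideanSpace ℝ (Fin 3)) → (EuclideanSpace ℝ (Fin 3))} (hf : AEStronglyMeasurable f volume)
    {M : ℝ} (hM : ∀ x, ‖f x‖ ≤ M) (h2 : ∫⁻ x, ‖f x‖ₑ ^ 2 < ⊤) :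
    eLpNorm f 3 volume < ⊤ := by
  have h2' : eLpNorm f 2 volume < ⊤ := by
    rw [eLpNorm_eq_lintegral_rpow_enorm_toReal two_ne_zero ENNReal.ofNat_ne_top, ENNReal.toReal_ofNat]
    refine ENNReal.rpow_lt_top_of_nonneg (by norm_num) (ne_of_lt ?_)
    refine lt_of_le_of_lt (le_of_eq (lintegral_congr fun x => ?_)) h2
    rw [← ENNReal.rpow_natCast]; norm_num
  have htop : eLpNorm f ∞ volume < ⊤ := by
    refine lt_of_le_of_lt (eLpNorm_exponent_top (f := f) (μ := volume) ▸
      eLpNormEssSup_le_of_ae_enorm_bound (C := ENNReal.ofReal M)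
        (Eventually.of_forall fun x => ?_)) ENNReal.ofReal_lt_top
    rw [← ofReal_norm]
    exact ENNReal.ofReal_le_ofReal (hM x)
  have hint := UnboundedOperators.eLpNorm_le_eLpNorm_rpow_mul_eLpNorm_top_rpow hf (p := 2) (q := 3)
    two_ne_zero (by norm_num)
  refine lt_of_le_of_lt hint (ENNReal.mul_lt_top ?_ ?_)
  · exact ENNReal.rpow_lt_top_of_nonneg (by norm_num) h2'.ne
  · exact ENNReal.rpow_lt_top_of_nonneg (by norm_num) htop.ne

end LogCubeCeiling

end Summit.NavierStokesRegularity.NavierStokesRegularity.Theorems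

end
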